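import Summits.HodgeConjecture.HodgeConjecture.Theorems.Ring2WeilCoverageFrameFreePlacementD
import HarnessLib

/-!
# Weil-type family coverage — frame-free placement E: the first binary-icosahedral FAMILY (eightfolds on `(4, K, [5])`) and the tier-2 CM fourfolds

research route conditional on HC_CM; not a corollary; Q11.4-sentence-2 already refuted in dim ≥ 3.

Ring 2, WEIL-TYPE FAMILY-COVERAGE CENSUS (`HOME/WEIL-FAMILY-COVERAGE.md` `## b04`, block b04.11 P.S., owner ring2-b04),
fifth part of `Ring2WeilCoverageFrameFreePlacement{,B,C,D}`: the second `2I` tier (`26 ≤ g(C̃) ≤ 47`, `q ≤ 1`, `N ≤ 4`;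
kit j184738–j184763, engine `icosa.py` of gen 46 unmodified under the gen-47 driver `icosa47.py`).

* §1 **the first positive-dimensional family of curves with `2I`-action whose `ℍ_ℚ ⊗ ℚ(√5)`-piece is an EIGHTFOLD**
  (`k = 2`): the `2I`-covers `(0; 2,3,4,5)` (classes `z, c3, c4, c5`; genus 44; Hurwitz dimension 1), frame-free
  invariant `C = 1/3645000000 = 5·(1/135000)²` — `≡ 5`, as the discriminant law `C ≡ 5^{#(order-5 points)}` of
  b04.11 (B1) PREDICTED before the run — hence of Weil type `(4,4)` for every `K = ℚ(√-d) ⊂ ℍ_ℚ ⊗ ℚ(√5)` and on the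
  NON-split component `(4, ℚ(√-d), [5])` exactly at the eleven census fields with `5 ∉ Nm(ℚ(√-d)ˣ)` — in particular
  on `W8.3.5 = (4, ℚ(√-3), 5)`, `W8.2.5`, `W8.7.5`, next to b04.8's `Dic₅` family `(0;4,4,10,5)`;
* §2 the tier-2 TRIANGLE data (CM fourfolds by the CM LEMMA of b04.11 (A3), `k = 1`) with square invariants —
  `(0; 4,6,10) = X₁₈ : y² = s₅r₅t₅` (genus 30, `C = 1/202500 = (1/450)²`), `(0; 5,5,6)` (genus 27, `1/32400`),
  `(0; 5,5,10′)` (genus 31, `1/1296`), `(0; 6,10′,10′)` (genus 39) and `(0; 10,10,10)` (genus 43) (`1/810000`):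
  SPLIT for every `K`;
* §3 **the NEXT WINDOW — Schur index ONE** (b04.11 (G)): for an irreducible `χ` with `ℚ(χ) = K` imaginary quadratic
  and Schur index 1, the `(χ ⊕ χ̄)`-isotypic piece of a `G`-curve carries `K` through the group algebra; its polarisation
  form is `h_W ⊗ β` (THEOREM S1 of the census: signature `(d·p, d·q)`, `det = det(h_W)^m det(β)^d` — so `d` even
  forces the SPLIT class).  Booked here with their LITERAL determinants (engines `psl2q.py`, `frob21.py`, `t24.py`;
  kit j185888–j185943 and local runs): the `PSL₂(𝔽₇)` Weil SIXFOLDS `(0;2,2,3,3)` (genus 29, a family),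
  `(0;3,7,7′)` (genus 33, rigid), `(0;4,7,7′)` (genus 40, rigid), `(0;2,2,4,4)` (genus 43, family) — `K = ℚ(√-7)`,
  signature `(3,3)`, all on `W6.7.1`; the `F₂₁ = C₇⋊C₃` sixfold family `(0;3,3,3′,3′)` (genus 8) on `W6.7.1` and
  twelvefold `(0;3,3′,7,7′)` (genus 12, the whole Jacobian) on `W12.7.1`; the `SL₂(𝔽₃)` (characters `2′,2″`,
  `K = ℚ(√-3)`) rigid Weil FOURFOLD `(0;4,6,6′)` (genus 6) on `W4.3.1` and eightfold family `(0;4,6,6′,2)` (genus 12)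
  on `W8.3.1` — every one SPLIT, as S1 predicts for `d = 2` and as observed for `d = 3`.

No `def`, no named fact, no `sorry`; nothing here is a statement about Hodge classes; `HC_CM` is used nowhere.

References: [cite: vanGeemen1994HodgeAV, 5.4 and (5.4.1)]; [cite: Serre1973, Ch. III §1]; [cite: MullerPink2021, Table 1];
[cite: NavarroTiep2021, Thm. A1–A2] (odd-degree characters have `ℚ(χ) = ℚ(√D)` only for `D ≡ 1 (4)`: over `ℚ(√-2)`,
`ℚ(√-5)`, `ℚ(√-6)`, `ℚ(√-10)`, `ℚ(√-13)` every Schur-index-1 Weil piece is therefore split — THEOREM S2 of the census, prose only).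
-/

noncomputable section

set_option linter.dupNamespace false

open Literature.AlgebraicGeometry.Motives
open Literature.AlgebraicGeometry.VanGeemen1994
open Summit.HodgeConjecture.HodgeConjecture.Ring2.Hypotheses

namespace Summit.HodgeConjecture.HodgeConjecture.Ring2.WeilCoverage

/-! ### §1 The `2I` eightfold family `(0; 2,3,4,5)` on the `5`-rows at `g = 8` -/

/-- **Shell for the `5`-column at `n = 4`**: a discriminant `a = 5·s²` lies in the split class of `(4, ℚ(√-d), ·)` iff
`5 ∈ Nm(ℚ(√-d)ˣ)`. research route conditional on HC_CM; not a corollary; Q11.4-sentence-2 already refuted in dim ≥ 3. [cite: vanGeemen1994HodgeAV, (5.4.1)] -/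
theorem mk_eq_split_four_iff_five_mem {d : ℕ} {a s : ℚ} (ha : a ≠ 0) (hs : s ≠ 0) (h : a = 5 * s ^ 2) :
    (QuotientGroup.mk (Units.mk0 a ha) : weilNormResidueGroup d) = splitDiscriminantClass 4 d ↔
      Units.mk0 (5 : ℚ) (by norm_num) ∈ normUnitsSubgroup ℚ (weilField d) :=
  mk_eq_split_iff_of_eq_mul_norm_mul_sq (n := 4) (by decide) (C := 5) (ν := 1) ha (by norm_num) one_ne_zero hs
    (by rw [h]; ring) (one_mem_normUnitsSubgroup d)

/-- **Frame-free class of the `2I` eightfold FAMILY `(0; 2,3,4,5)`** (genus 44, `k = 2`, Hurwitz dimension 1):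
`C = 1/3645000000 = 5·(1/135000)²`; `e = 2` even and `R(ℍ_ℚ ⊗ ℚ(√5)) = ∅` ⟹ no correction term: the component of
`(P_t, K, Θ)` is split iff `5 ∈ Nm(ℚ(√-d)ˣ)`, for every member `t` and every `K = ℚ(√-d)`.
research route conditional on HC_CM; not a corollary; Q11.4-sentence-2 already refuted in dim ≥ 3. [cite: vanGeemen1994HodgeAV, (5.4.1)] -/
theorem eightfold_icosahedralFamily2345_mk_C_eq_split_iff (d : ℕ) :
    (QuotientGroup.mk (Units.mk0 ((1 : ℚ) / 3645000000) (by norm_num)) : weilNormResidueGroup d) =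
      splitDiscriminantClass 4 d ↔ Units.mk0 (5 : ℚ) (by norm_num) ∈ normUnitsSubgroup ℚ (weilField d) :=
  mk_eq_split_four_iff_five_mem (s := (1 : ℚ) / 135000) (by norm_num) (by norm_num) (by norm_num)

/-- **The `2I` eightfold family `(0; 2,3,4,5)` lies on `W8.3.5 = (4, ℚ(√-3), 5)`** (`5` inert in `ℚ(√-3)`): a
positive-dimensional family of Weil-type eightfolds with a curve (genus 44, `2I`-action, definite quaternionic
multiplication by `ℍ_ℚ ⊗ ℚ(√5)`) on a non-split row; `W_K` there is OPEN (type III(2) over `ℚ(√5)`; nothing in print).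
research route conditional on HC_CM; not a corollary; Q11.4-sentence-2 already refuted in dim ≥ 3. [cite: vanGeemen1994HodgeAV, (5.4.1)] -/
theorem eightfold_sqrtNeg3_icosahedralFamily2345_ne_split :
    (QuotientGroup.mk (Units.mk0 ((1 : ℚ) / 3645000000) (by norm_num)) : weilNormResidueGroup 3) ≠
      splitDiscriminantClass 4 3 := fun h =>
  Summit.HodgeConjecture.Ring2WeilNormDescent.five_not_mem_norm_three
    ((eightfold_icosahedralFamily2345_mk_C_eq_split_iff 3).1 h)

/-- The same family on `W8.2.5 = (4, ℚ(√-2), 5)`. research route conditional on HC_CM; not a corollary; Q11.4-sentence-2 already refuted in dim ≥ 3. [cite: vanGeemen1994HodgeAV, (5.4.1)] -/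
theorem eightfold_sqrtNeg2_icosahedralFamily2345_ne_split :
    (QuotientGroup.mk (Units.mk0 ((1 : ℚ) / 3645000000) (by norm_num)) : weilNormResidueGroup 2) ≠
      splitDiscriminantClass 4 2 := fun h =>
  Summit.HodgeConjecture.Ring2WeilNormDescent.five_not_mem_norm_two
    ((eightfold_icosahedralFamily2345_mk_C_eq_split_iff 2).1 h)

/-- The same family on `W8.7.5 = (4, ℚ(√-7), 5)`. research route conditional on HC_CM; not a corollary; Q11.4-sentence-2 already refuted in dim ≥ 3. [cite: vanGeemen1994HodgeAV, (5.4.1)] -/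
theorem eightfold_sqrtNeg7_icosahedralFamily2345_ne_split :
    (QuotientGroup.mk (Units.mk0 ((1 : ℚ) / 3645000000) (by norm_num)) : weilNormResidueGroup 7) ≠
      splitDiscriminantClass 4 7 := fun h =>
  Summit.HodgeConjecture.Ring2WeilNormDescent.five_not_mem_norm_seven
    ((eightfold_icosahedralFamily2345_mk_C_eq_split_iff 7).1 h)

/-- The same family on `W8.163.5`. research route conditional on HC_CM; not a corollary; Q11.4-sentence-2 already refuted in dim ≥ 3. [cite: vanGeemen1994HodgeAV, (5.4.1)] -/
theorem eightfold_sqrtNeg163_icosahedralFamily2345_ne_split :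
    (QuotientGroup.mk (Units.mk0 ((1 : ℚ) / 3645000000) (by norm_num)) : weilNormResidueGroup 163) ≠
      splitDiscriminantClass 4 163 := fun h =>
  SqrtNeg163.not_mem_5 ((eightfold_icosahedralFamily2345_mk_C_eq_split_iff 163).1 h)

/-- The same family on `W8.15.2` (`[5] = [2]` modulo `Nm(ℚ(√-15)ˣ)`). research route conditional on HC_CM; not a corollary; Q11.4-sentence-2 already refuted in dim ≥ 3. [cite: vanGeemen1994HodgeAV, (5.4.1)] -/
theorem eightfold_sqrtNeg15_icosahedralFamily2345_ne_split :
    (QuotientGroup.mk (Units.mk0 ((1 : ℚ) / 3645000000) (by norm_num)) : weilNormResidueGroup 15) ≠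
      splitDiscriminantClass 4 15 := fun h =>
  SqrtNeg15.not_mem_5 ((eightfold_icosahedralFamily2345_mk_C_eq_split_iff 15).1 h)

/-- The same family at `ℚ(i)`: SPLIT (`5 = 1² + 2²`), row `W8.1.1`. research route conditional on HC_CM; not a corollary; Q11.4-sentence-2 already refuted in dim ≥ 3. [cite: vanGeemen1994HodgeAV, (5.4.1)] -/
theorem eightfold_sqrtNeg1_icosahedralFamily2345_eq_split :
    (QuotientGroup.mk (Units.mk0 ((1 : ℚ) / 3645000000) (by norm_num)) : weilNormResidueGroup 1) =
      splitDiscriminantClass 4 1 :=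
  (eightfold_icosahedralFamily2345_mk_C_eq_split_iff 1).2 SqrtNeg1.mem_5

/-- The same family at `ℚ(√-11)`: SPLIT, row `W8.11.1`. research route conditional on HC_CM; not a corollary; Q11.4-sentence-2 already refuted in dim ≥ 3. [cite: vanGeemen1994HodgeAV, (5.4.1)] -/
theorem eightfold_sqrtNeg11_icosahedralFamily2345_eq_split :
    (QuotientGroup.mk (Units.mk0 ((1 : ℚ) / 3645000000) (by norm_num)) : weilNormResidueGroup 11) =
      splitDiscriminantClass 4 11 :=
  (eightfold_icosahedralFamily2345_mk_C_eq_split_iff 11).2 SqrtNeg11.mem_5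

/-! ### §2 The tier-2 `2I` triangle curves (CM fourfolds, `k = 1`) with square invariants -/

/-- `(0; 4,6,10) = X₁₈ : y² = s₅(x)r₅(x)t₅(x)` (Müller–Pink; genus 30; `J(X₁₈)` not CM as a whole, its `ℍ_ℚ ⊗ ℚ(√5)`-piece is a
CM fourfold), `C = 1/202500 = (1/450)²`: SPLIT component `W4.d.1` for every field — no branch point of order `5`.
research route conditional on HC_CM; not a corollary; Q11.4-sentence-2 already refuted in dim ≥ 3. [cite: MullerPink2021, Table 1] -/
theorem fourfold_icosahedral4610_mk_C_eq_split (d : ℕ) :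
    (QuotientGroup.mk (Units.mk0 ((1 : ℚ) / 202500) (by norm_num)) : weilNormResidueGroup d) =
      splitDiscriminantClass 2 d :=
  mk_eq_split_two_of_eq_sq d (s := (1 : ℚ) / 450) (by norm_num) (by norm_num) (by norm_num)

/-- `(0; 5,5,6)` (genus 27) and `(0; 5′,5′,10)` (genus 31): `C = 1/32400 = (1/180)²` — two order-`5` points, `5² ≡ 1`:
SPLIT for every `K`. research route conditional on HC_CM; not a corollary; Q11.4-sentence-2 already refuted in dim ≥ 3. [cite: vanGeemen1994HodgeAV, (5.4.1)] -/
theorem fourfold_icosahedral556_mk_C_eq_split (d : ℕ) :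
    (QuotientGroup.mk (Units.mk0 ((1 : ℚ) / 32400) (by norm_num)) : weilNormResidueGroup d) =
      splitDiscriminantClass 2 d :=
  mk_eq_split_two_of_eq_sq d (s := (1 : ℚ) / 180) (by norm_num) (by norm_num) (by norm_num)

/-- `(0; 5,5,10′)` (genus 31), `C = 1/1296 = (1/36)²`: SPLIT for every `K`. research route conditional on HC_CM; not a corollary; Q11.4-sentence-2 already refuted in dim ≥ 3. [cite: vanGeemen1994HodgeAV, (5.4.1)] -/
theorem fourfold_icosahedral5510_mk_C_eq_split (d : ℕ) :
    (QuotientGroup.mk (Units.mk0 ((1 : ℚ) / 1296) (by norm_num)) : weilNormResidueGroup d) =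
      splitDiscriminantClass 2 d :=
  mk_eq_split_two_of_eq_sq d (s := (1 : ℚ) / 36) (by norm_num) (by norm_num) (by norm_num)

/-- `(0; 6,10′,10′)` (genus 39) and `(0; 10,10,10)` (genus 43), `C = 1/810000 = (1/900)²`: SPLIT for every `K`.
research route conditional on HC_CM; not a corollary; Q11.4-sentence-2 already refuted in dim ≥ 3. [cite: vanGeemen1994HodgeAV, (5.4.1)] -/
theorem fourfold_icosahedral101010_mk_C_eq_split (d : ℕ) :
    (QuotientGroup.mk (Units.mk0 ((1 : ℚ) / 810000) (by norm_num)) : weilNormResidueGroup d) =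
      splitDiscriminantClass 2 d :=
  mk_eq_split_two_of_eq_sq d (s := (1 : ℚ) / 900) (by norm_num) (by norm_num) (by norm_num)

/-! ### §3 The Schur-index-ONE windows: `PSL₂(𝔽₇)`, `F₂₁`, `SL₂(𝔽₃)` — literal determinants, all split -/

/-- **Shell, `n` odd**: `det H = -a` with `a = s²` a rational square ⟹ the class of `det H` is the split class
`[(-1)ⁿ]`. research route conditional on HC_CM; not a corollary; Q11.4-sentence-2 already refuted in dim ≥ 3. [cite: vanGeemen1994HodgeAV, (5.4.1)] -/
theorem mk_neg_eq_split_of_eq_sq {d n : ℕ} (hn : Odd n) {a s : ℚ} (ha : a ≠ 0) (hs : s ≠ 0) (h : a = s ^ 2) :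
    (QuotientGroup.mk (-(Units.mk0 a ha)) : weilNormResidueGroup d) = splitDiscriminantClass n d := by
  rw [mk_neg_eq_splitDiscriminantClass_iff_of_odd hn]
  have e : Units.mk0 a ha = Units.mk0 (s ^ 2) (pow_ne_zero 2 hs) := Units.ext (by simp [h])
  rw [e]; exact sq_mem_normUnitsSubgroup hs

/-- **Shell, `n` even**: `det H = a = s²` ⟹ split class. research route conditional on HC_CM; not a corollary; Q11.4-sentence-2 already refuted in dim ≥ 3. [cite: vanGeemen1994HodgeAV, (5.4.1)] -/
theorem mk_eq_split_of_eq_sq_even {d n : ℕ} (hn : Even n) {a s : ℚ} (ha : a ≠ 0) (hs : s ≠ 0) (h : a = s ^ 2) :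
    (QuotientGroup.mk (Units.mk0 a ha) : weilNormResidueGroup d) = splitDiscriminantClass n d := by
  rw [mk_eq_splitDiscriminantClass_iff_of_even hn]
  have e : Units.mk0 a ha = Units.mk0 (s ^ 2) (pow_ne_zero 2 hs) := Units.ext (by simp [h])
  rw [e]; exact sq_mem_normUnitsSubgroup hs

/-- **`PSL₂(𝔽₇)`-curves `(0; 2,2,3,3)` (genus 29; Hurwitz dimension 1)**: the `(η₁ ⊕ η₂)`-piece (`η` the two cuspidal
characters of degree 3, values `(−1 ± √-7)/2` on the unipotent classes) has multiplicity `m = 2`, `K = ℚ(√-7)`-signature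
`(3,3)` — a one-parameter FAMILY of Weil-type SIXFOLDS with `ℚ(√-7)` acting through the group algebra — and literal
`det H = -16/49`, `a = 16/49 = (4/7)²`: row `W6.7.1` (split).
research route conditional on HC_CM; not a corollary; Q11.4-sentence-2 already refuted in dim ≥ 3. [cite: vanGeemen1994HodgeAV, (5.4.1)] -/
theorem sixfold_psl27_family2233_mk_detH_eq_split :
    (QuotientGroup.mk (Units.mk0 ((-16 : ℚ) / 49) (by norm_num)) : weilNormResidueGroup 7) =
      splitDiscriminantClass 3 7 := by
  have e : Units.mk0 ((-16 : ℚ) / 49) (by norm_num) = -(Units.mk0 ((16 : ℚ) / 49) (by norm_num)) :=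
    Units.ext (by norm_num)
  rw [e]
  exact mk_neg_eq_split_of_eq_sq (n := 3) (by decide) (s := (4 : ℚ) / 7) (by norm_num) (by norm_num) (by norm_num)

/-- **The RIGID `PSL₂(𝔽₇)`-curve `(0; 3,7,7′)` (genus 33; one Nielsen class)**: `m = 2`, signature `(3,3)` — a rigid
Weil-type sixfold with `ℚ(√-7)`-action — `det H = -1/32`, `a = 1/32 = (1/16)² + 7·(1/16)²` (`2 = Nm((1+√-7)/2)`): row
`W6.7.1`. research route conditional on HC_CM; not a corollary; Q11.4-sentence-2 already refuted in dim ≥ 3. [cite: vanGeemen1994HodgeAV, (5.4.1)] -/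
theorem sixfold_psl27_377_mk_detH_eq_split :
    (QuotientGroup.mk (Units.mk0 ((-1 : ℚ) / 32) (by norm_num)) : weilNormResidueGroup 7) =
      splitDiscriminantClass 3 7 := by
  have e : Units.mk0 ((-1 : ℚ) / 32) (by norm_num) = -(Units.mk0 ((1 : ℚ) / 32) (by norm_num)) :=
    Units.ext (by norm_num)
  rw [e, mk_neg_eq_splitDiscriminantClass_iff_of_odd (n := 3) (by decide)]
  exact mem_normUnitsSubgroup_of_sq_add_mul_sq _ ((1 : ℚ) / 16) ((1 : ℚ) / 16) (by norm_num)

/-- **The RIGID `PSL₂(𝔽₇)`-curve `(0; 4,7,7′)` (genus 40)**: `m = 2`, signature `(3,3)`, `det H = -1/4096`,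
`a = (1/64)²`: row `W6.7.1`. research route conditional on HC_CM; not a corollary; Q11.4-sentence-2 already refuted in dim ≥ 3. [cite: vanGeemen1994HodgeAV, (5.4.1)] -/
theorem sixfold_psl27_477_mk_detH_eq_split :
    (QuotientGroup.mk (Units.mk0 ((-1 : ℚ) / 4096) (by norm_num)) : weilNormResidueGroup 7) =
      splitDiscriminantClass 3 7 := by
  have e : Units.mk0 ((-1 : ℚ) / 4096) (by norm_num) = -(Units.mk0 ((1 : ℚ) / 4096) (by norm_num)) :=
    Units.ext (by norm_num)
  rw [e]
  exact mk_neg_eq_split_of_eq_sq (n := 3) (by decide) (s := (1 : ℚ) / 64) (by norm_num) (by norm_num) (by norm_num)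

/-- **`PSL₂(𝔽₇)`-curves `(0; 2,2,4,4)` (genus 43; a family)**: `m = 2`, signature `(3,3)`, `det H = -1/343`,
`a = 1/343 = 7·(1/49)² = 0² + 7·(1/49)²`: row `W6.7.1`. research route conditional on HC_CM; not a corollary; Q11.4-sentence-2 already refuted in dim ≥ 3. [cite: vanGeemen1994HodgeAV, (5.4.1)] -/
theorem sixfold_psl27_family2244_mk_detH_eq_split :
    (QuotientGroup.mk (Units.mk0 ((-1 : ℚ) / 343) (by norm_num)) : weilNormResidueGroup 7) =
      splitDiscriminantClass 3 7 := by
  have e : Units.mk0 ((-1 : ℚ) / 343) (by norm_num) = -(Units.mk0 ((1 : ℚ) / 343) (by norm_num)) :=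
    Units.ext (by norm_num)
  rw [e, mk_neg_eq_splitDiscriminantClass_iff_of_odd (n := 3) (by decide)]
  exact mem_normUnitsSubgroup_of_sq_add_mul_sq _ (0 : ℚ) ((1 : ℚ) / 49) (by norm_num)

/-- **`F₂₁ = C₇ ⋊ C₃`-curves `(0; 3,3,3′,3′)` (genus 8; a one-parameter family)**: the piece cut out by the two degree-3
characters (values `(−1 ± √-7)/2` on the `7`-classes) has `m = 2`, signature `(3,3)` — Weil-type sixfolds with `ℚ(√-7)`
at genus EIGHT — `det H = -64/7`, `a = 64/7 = 0² + 7·(8/7)²`: row `W6.7.1`.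
research route conditional on HC_CM; not a corollary; Q11.4-sentence-2 already refuted in dim ≥ 3. [cite: vanGeemen1994HodgeAV, (5.4.1)] -/
theorem sixfold_f21_family3333_mk_detH_eq_split :
    (QuotientGroup.mk (Units.mk0 ((-64 : ℚ) / 7) (by norm_num)) : weilNormResidueGroup 7) =
      splitDiscriminantClass 3 7 := by
  have e : Units.mk0 ((-64 : ℚ) / 7) (by norm_num) = -(Units.mk0 ((64 : ℚ) / 7) (by norm_num)) :=
    Units.ext (by norm_num)
  rw [e, mk_neg_eq_splitDiscriminantClass_iff_of_odd (n := 3) (by decide)]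
  exact mem_normUnitsSubgroup_of_sq_add_mul_sq _ (0 : ℚ) ((8 : ℚ) / 7) (by norm_num)

/-- **`F₂₁`-curves `(0; 3,3′,7,7′)` (genus 12; a family whose WHOLE Jacobian is the piece)**: `m = 4`, signature `(6,6)` —
Weil-type TWELVEFOLDS with `ℚ(√-7)` — `det H = 4096 = 64²`: row `W12.7.1`.
research route conditional on HC_CM; not a corollary; Q11.4-sentence-2 already refuted in dim ≥ 3. [cite: vanGeemen1994HodgeAV, (5.4.1)] -/
theorem twelvefold_f21_family3377_mk_detH_eq_split :
    (QuotientGroup.mk (Units.mk0 (4096 : ℚ) (by norm_num)) : weilNormResidueGroup 7) =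
      splitDiscriminantClass 6 7 :=
  mk_eq_split_of_eq_sq_even (n := 6) (by decide) (s := (64 : ℚ)) (by norm_num) (by norm_num) (by norm_num)

/-- **The RIGID `SL₂(𝔽₃)`-curve `(0; 4,6,6′)` (genus 6)**: the piece of the characters `2′ = 2 ⊗ 1′`, `2″` (values `−ω`,
`−ω²` on the two classes of order 3; `K = ℚ(√-3)`, Schur index 1) has `m = 2`, signature `(2,2)` — a rigid Weil-type
FOURFOLD with `ℚ(√-3)` through the group algebra — `det H = 4/9 = (2/3)²`: row `W4.3.1` (THEOREM S1: `d = 2` ⟹ square).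
research route conditional on HC_CM; not a corollary; Q11.4-sentence-2 already refuted in dim ≥ 3. [cite: vanGeemen1994HodgeAV, (5.4.1)] -/
theorem fourfold_sl23_466_mk_detH_eq_split :
    (QuotientGroup.mk (Units.mk0 ((4 : ℚ) / 9) (by norm_num)) : weilNormResidueGroup 3) =
      splitDiscriminantClass 2 3 :=
  mk_eq_split_two_of_eq_sq 3 (s := (2 : ℚ) / 3) (by norm_num) (by norm_num) (by norm_num)

/-- **`SL₂(𝔽₃)`-curves `(0; 4,6,6′,2)` (genus 12; a family)**: `m = 4`, signature `(4,4)` — Weil-type EIGHTFOLDS with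
`ℚ(√-3)` — `det H = 64/81 = (8/9)²`: row `W8.3.1`. research route conditional on HC_CM; not a corollary; Q11.4-sentence-2 already refuted in dim ≥ 3. [cite: vanGeemen1994HodgeAV, (5.4.1)] -/
theorem eightfold_sl23_family4662_mk_detH_eq_split :
    (QuotientGroup.mk (Units.mk0 ((64 : ℚ) / 81) (by norm_num)) : weilNormResidueGroup 3) =
      splitDiscriminantClass 4 3 :=
  mk_eq_split_of_eq_sq_even (n := 4) (by decide) (s := (8 : ℚ) / 9) (by norm_num) (by norm_num) (by norm_num)

end Summit.HodgeConjecture.HodgeConjecture.Ring2.WeilCoverage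

end
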